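import Summits.BirchSwinnertonDyer.BirchSwinnertonDyer.Theorems.GenusKolyvaginAtTwoShaCardDvdPowAtTwoPosTDefectOneBitLaw
import Literature.NumberTheory.EllipticCurves.CasselsTateResCorAdjoint
import Literature.NumberTheory.EllipticCurves.ShaTorsion
import Literature.GroupTheory.FiniteAbelian.CharacterModuleUnitAddCircle
import HarnessLib

/-!
# Route `GenusKolyvaginAtTwo`, residual `OffCutResidualAtTwo` (stmt-BirchSwinnertonDyer-25503), pen LINE 24 «strict_def2», stub X⁼² / budget B⁼²:
# THE ONE-BIT LAW IS EXACT — `#Ш(E/K)[2^∞] = #Ш(E/K)[2] · #Ш(E/ℚ)[2^∞]` when the Kramer class is NOT in `Ш(E/ℚ)`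
# (Kramer's `Φ = 0`: LINE 24's case A), modulo Cassels–Tate res/cor adjointness; hence the relaxed index is `A ≥ 2·#Ш(E/K)[2]` (`= 8`)

Seat `bsd-line-gk2-p4` g27 (WIDTH-5 attach, cell `bsd-f1-sign2`), `--supports stmt-BirchSwinnertonDyer-25503` (helper; closes nothing); sequel of
`…PosTDefectOneBitLaw` (p767735).  THEOREMS ONLY (no definition, no new named fact, no `sorry`); standard axioms.  **CONDITIONAL** on the tree's
named print fact `Literature.NumberTheory.EllipticCurves.casselsTate_pairing_resCor` (Fisher 2003 Prop. 2.16: restriction and corestriction are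
adjoint for the Cassels–Tate pairing; unproved in the tree), displayed as the hypothesis `hRC`, and on the two corestriction binders of the
prequel.  **BSD is NOT proved by this file; X⁼² / LINE 24 / 25503 are NOT proved; no item is closed.**

WHAT (memo `X2-DEF2-ONEBIT-gk2p4-g27.md` = evidence #13 on 25503, §2(iii)–(iv)).  `X = Ш(E/K)[2^∞]`, `Y = Ш(E/ℚ)[2^∞]` (finite), twin with
`Ш(T/ℚ)[2^∞] = 0`, so `τ_* = id` on `X` and `#X ≤ #X[2] · #Y` (prequel).  CASE A = «no non-zero class of `Y` dies in `Ш(E/K)`» (the Kramer class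
`c_w ∉ Ш(E/ℚ)`, i.e. Kramer's `Φ = Sel₂(E) ∩ Sel₂(E^d) = 0`; on LINE 24's DEF-2 identity-prime cell this is `ρ_q = 2`).
* §1 algebra (the argument of `CasselsTateResCorAdjoint` §3, re-proved here because private there): left kernel of a «kernel = divisible» pairing
  on a finite `2`-primary component of a torsion group is trivial.
* §2 **`natCard_torsionBy_mul_natCard_le_natCard_shaPrimary_of_adjoint`** — case A + `hRC` ⟹ **`#Ш(E/K)[2] · #Y ≤ #X`**: `cor` kills `X[2]`
  (`res cor x = 2x = 0`, `cor x ∈ Y ∩ ker res = 0`), so `#X = #ker(cor|_X) · #cor(X) ≥ #X[2] · #cor(X)`; and `y ↦ ⟨y, cor ·⟩_ℚ = ⟨res y, ·⟩_K`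
  embeds `Y` into `Hom(cor X, ℚ/ℤ)` (a `y` orthogonal to `cor X` has `res y` orthogonal to `X`, hence `res y = 0` by §1, hence `y = 0` by case A),
  so `#Y ≤ #cor(X)`.
* §3 **`natCard_shaPrimary_eq_torsionBy_mul_natCard_of_adjoint`** — with the prequel's upper bound: **`#Ш(E/K)[2^∞] = #Ш(E/K)[2] · #Ш(E/ℚ)[2^∞]`**
  in case A (`= 4·#Y` on a one-block cell): X⁼²'s upper half `#X ∣ 4^(M₀)` ⟺ `#Y ∣ 4^(M₀−1)`, one bit below B₂.
* §4 **`two_mul_natCard_torsionBy_le_relIndex_of_adjoint_of_frame`** — on the pair-sandwich frame (`E(K)[2] = 0`, `rank E(K) ≤ 1`, anti-invariant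
  `y` with `2^(M+1) ∤ y`): the relaxed index `A = [res⁻¹Ш(E_K) : Ш(E/ℚ) ∩ ·]` satisfies **`2 · #Ш(E/K)[2] ≤ A`** (invariant classes are
  restrictions, the Kramer class, §3); `eight_le_relIndex_of_adjoint_of_frame`: **`A ≥ 8`** when `#Ш(E/K)[2] = 4` — the pen's budget B⁼²_A
  «`A · A′ ≤ 4`» (card v1.1 §P1) is FALSE on its own frame (structure side, modulo Fisher 2.16 and the cor binders).

References: [Fisher2003] Prop. 2.16; [Kramer1981] Thm. 1, Prop. 7, Thm. 2; [MilneADT2006] I Prop. 6.9, Thm. 6.13; [GrossLMS1991] §5 (5.1)–(5.3);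
[SerreGaloisCohomology1997] I §2.4 Prop. 9; [Serre1973] VI §1.1 Prop. 2.
-/

set_option autoImplicit false
set_option linter.dupNamespace false -- `Summit.<P>.<Sub>` repeats `BirchSwinnertonDyer` (D-0017)

noncomputable section

open scoped Classical

namespace Summit.BirchSwinnertonDyer.BirchSwinnertonDyer.Theorems.GenusExact.PlusDescent.OneBit

open Literature.NumberTheory.EllipticCurves Literature.NumberTheory.GaloisRepresentations WeierstrassCurve NumberField
  IsDedekindDomain Field AddSubgroup
open Summit.BirchSwinnertonDyer.BirchSwinnertonDyer.Theorems.GenusExact.PlusDescent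
open Summit.BirchSwinnertonDyer.BirchSwinnertonDyer.Theorems.GenusExact.SelmerDescent (mem_comap_resBaseChange_shaPrimary_iff
  two_nsmul_eq_zero_of_resBaseChange_eq_zero)
open Literature.GroupTheory.FiniteAbelian (nonempty_addMonoidHom_ratAddCircle_addEquiv)

/-! ## §1 Algebra: trivial left kernel on a finite `2`-primary component -/

section Algebra

variable {Q : Type*} [AddCommGroup Q] {G : Type*} [AddCommGroup G]

/-- An odd multiple of any element of a torsion group is `2`-primary. [folklore] -/
theorem exists_odd_nsmul_mem_primaryComponent_two (htors : AddMonoid.IsTorsion G) (y : G) :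
    ∃ m : ℕ, Odd m ∧ m • y ∈ AddCommGroup.primaryComponent G 2 := by
  obtain ⟨e, m, hm, hn⟩ := Nat.exists_eq_two_pow_mul_odd (htors y).addOrderOf_pos.ne'
  refine ⟨m, hm, (AddCommGroup.mem_primaryComponent (G := G)).mpr ⟨e, ?_⟩⟩
  rw [← mul_nsmul', ← hn]
  exact addOrderOf_nsmul_eq_zero y

/-- **Trivial left kernel on a finite `2`-primary component** of a torsion group, for a pairing whose left kernel is the divisible subgroup
(the argument of `CasselsTateResCorAdjoint` §3 / `CasselsTateOmegaBalanced` §1, which are private there): if `a` is `2`-primary and pairs to `0`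
with every `2`-primary element, then `a = 0`. [cite: MilneADT2006, I Thm. 6.13] -/
theorem eq_zero_of_forall_apply_primaryComponent_eq_zero (htors : AddMonoid.IsTorsion G)
    (B : G →+ G →+ Q) (hker : ∀ x, (∀ y, B x y = 0) → x ∈ AddSubgroup.divisibleElements G)
    [Finite (AddCommGroup.primaryComponent G 2)] {a : G}
    (ha : a ∈ AddCommGroup.primaryComponent G 2)
    (horth : ∀ y ∈ AddCommGroup.primaryComponent G 2, B a y = 0) : a = 0 := by
  have hcop : ∀ {v : Q} {m n : ℕ}, Nat.Coprime m n → m • v = 0 → n • v = 0 → v = 0 := fun hmn hm hn ↦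
    AddMonoid.addOrderOf_eq_one_iff.mp (Nat.eq_one_of_dvd_coprimes hmn
      (addOrderOf_dvd_of_nsmul_eq_zero hm) (addOrderOf_dvd_of_nsmul_eq_zero hn))
  have hcopG : ∀ {v : G} {m n : ℕ}, Nat.Coprime m n → m • v = 0 → n • v = 0 → v = 0 := fun hmn hm hn ↦
    AddMonoid.addOrderOf_eq_one_iff.mp (Nat.eq_one_of_dvd_coprimes hmn
      (addOrderOf_dvd_of_nsmul_eq_zero hm) (addOrderOf_dvd_of_nsmul_eq_zero hn))
  obtain ⟨k, hk⟩ := (AddCommGroup.mem_primaryComponent (G := G)).mp ha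
  have hleft : ∀ y, B a y = 0 := fun y ↦ by
    obtain ⟨m, hm, hmy⟩ := exists_odd_nsmul_mem_primaryComponent_two htors y
    have h1 : m • B a y = 0 := by rw [← map_nsmul]; exact horth _ hmy
    have h2 : 2 ^ k • B a y = 0 := by
      rw [← AddMonoidHom.nsmul_apply, ← map_nsmul, hk, map_zero, AddMonoidHom.zero_apply]
    exact hcop (hm.coprime_two_left.pow_left k) h2 h1
  obtain ⟨z, hz⟩ := (AddSubgroup.mem_divisibleElements_iff _ a).mp (hker a hleft) _
    (Nat.card_pos (α := AddCommGroup.primaryComponent G 2))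
  obtain ⟨m, hm, hmz⟩ := exists_odd_nsmul_mem_primaryComponent_two htors z
  have hNz : Nat.card (AddCommGroup.primaryComponent G 2) • (m • z) = 0 := by
    have h := addOrderOf_dvd_natCard (⟨m • z, hmz⟩ : AddCommGroup.primaryComponent G 2)
    rw [addOrderOf_dvd_iff_nsmul_eq_zero] at h
    have h' := congrArg Subtype.val h
    rw [AddSubmonoidClass.coe_nsmul, ZeroMemClass.coe_zero] at h'
    exact h'
  have hma : m • a = 0 := by rw [← hz, ← mul_nsmul', mul_comm, mul_nsmul', hNz]
  exact hcopG (hm.coprime_two_left.pow_left k) hk hma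

end Algebra

/-! ## §2 The lower bound `#Ш(E/K)[2] · #Ш(E/ℚ)[2^∞] ≤ #Ш(E/K)[2^∞]` in case A, modulo adjointness -/

section LowerBound

variable (W : WeierstrassCurve ℚ) [W.IsElliptic] (K : Type) [Field K] [NumberField K]

/-- **`#Ш(E/K)[2] · #Ш(E/ℚ)[2^∞] ≤ #Ш(E/K)[2^∞]` in case A, modulo Cassels–Tate res/cor adjointness.**  `E = W/ℚ` elliptic, `K` imaginary
quadratic, `σ ≠ 1`; `hRC` = the named fact `casselsTate_pairing_resCor` (Fisher 2003 Prop. 2.16); the twin `T = W.quadraticTwist (discr K)` has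
`Ш(T/ℚ)[2^∞] = 0`; corestriction maps `Ш` to `Ш` for `T` and for `E` (`hcorT`, `hcorE`); both `2`-primary parts finite; and CASE A (`hA`): no
non-zero `2`-primary class of `Ш(E/ℚ)` dies in `Ш(E/K)`.  Then `cor|_X` kills `X[2]` and `Y ↪ Hom(cor X, ℚ/ℤ)`, `y ↦ ⟨y, ·⟩_ℚ|_{cor X} = ⟨res y, ·⟩_K`
(§1 for the kernel), so `#X[2] · #Y ≤ #ker(cor|_X) · #cor(X) = #X`.  [cite: Fisher2003, Prop. 2.16] [cite: MilneADT2006, I Prop. 6.9, Thm. 6.13]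
[cite: Kramer1981, Thm. 1, Prop. 7] [cite: Serre1973, VI §1.1 Prop. 2] -/
theorem natCard_torsionBy_mul_natCard_le_natCard_shaPrimary_of_adjoint (hIQ : IsImaginaryQuadratic K) {σ : K ≃ₐ[ℚ] K} (hσ1 : σ ≠ 1)
    (hRC : casselsTate_pairing_resCor K σ hIQ.1 hσ1)
    [Finite (AddCommGroup.primaryComponent (↥W.sha) 2)] [Finite (AddCommGroup.primaryComponent (↥(W.baseChange K).sha) 2)]
    (hT0 : ∀ x ∈ AddCommGroup.primaryComponent (↥(W.quadraticTwist (NumberField.discr K : ℚ)).sha) 2, x = 0)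
    (hcorT : ∀ c : ((W.quadraticTwist (NumberField.discr K : ℚ)).baseChange K).galH1,
        c ∈ ((W.quadraticTwist (NumberField.discr K : ℚ)).baseChange K).sha →
          corBaseChange K (W.quadraticTwist (NumberField.discr K : ℚ)) σ hIQ.1 hσ1 c ∈ (W.quadraticTwist (NumberField.discr K : ℚ)).sha)
    (hcorE : ∀ c : (W.baseChange K).galH1, c ∈ (W.baseChange K).sha → corBaseChange K W σ hIQ.1 hσ1 c ∈ W.sha)
    (hA : ∀ η : W.galH1, η ∈ (AddCommGroup.primaryComponent (↥W.sha) 2).map W.sha.subtype → resBaseChange W K η = 0 → η = 0) :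
    Nat.card (AddSubgroup.torsionBy (↥(W.baseChange K).sha) ((2 : ℕ) : ℤ)) * Nat.card (AddCommGroup.primaryComponent (↥W.sha) 2) ≤
      Nat.card (AddCommGroup.primaryComponent (↥(W.baseChange K).sha) 2) := by
  haveI : Fact (Nat.Prime 2) := ⟨Nat.prime_two⟩
  haveI hell : (W.baseChange K).IsElliptic := inferInstanceAs ((W.map (algebraMap ℚ K)).IsElliptic)
  have h2 : Module.finrank ℚ K = 2 := hIQ.1
  obtain ⟨Bℚ, BK, ⟨hℚi, -⟩, ⟨hKi, -⟩, hadj⟩ := hRC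
  set X : AddSubgroup ↥(W.baseChange K).sha := AddCommGroup.primaryComponent (↥(W.baseChange K).sha) 2 with hX
  set Y : AddSubgroup ↥W.sha := AddCommGroup.primaryComponent (↥W.sha) 2 with hY
  set Ys : AddSubgroup W.galH1 := Y.map W.sha.subtype with hYs
  set res := resBaseChange W K with hres
  set cor := corBaseChange K W σ h2 hσ1 with hcor
  -- corestriction at the level of `Ш` (the binder `hcorE`)
  set corSha : ↥(W.baseChange K).sha →+ ↥W.sha :=
    (cor.comp (W.baseChange K).sha.subtype).codRestrict W.sha (fun c ↦ hcorE c c.2) with hcorSha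
  have hcorSha_coe : ∀ c : ↥(W.baseChange K).sha, ((corSha c : ↥W.sha) : W.galH1) = cor (c : (W.baseChange K).galH1) := fun _ ↦ rfl
  -- `cor` of a `2`-primary class is `2`-primary
  have hcorY : ∀ x : ↥(W.baseChange K).sha, x ∈ X → corSha x ∈ Y := by
    intro x hx
    obtain ⟨k, hk⟩ := (AddCommGroup.mem_primaryComponent).mp hx
    apply (AddCommGroup.mem_primaryComponent).mpr
    refine ⟨k, ?_⟩
    rw [← map_nsmul, hk, map_zero]
  set C : AddSubgroup ↥W.sha := X.map corSha with hC
  have hCY : C ≤ Y := by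
    rintro _ ⟨x, hx, rfl⟩
    exact hcorY x hx
  haveI hCfin : Finite C := by
    have h : ((C : AddSubgroup ↥W.sha) : Set ↥W.sha).Finite := by rw [hC, AddSubgroup.coe_map]; exact (Set.toFinite _).image _
    exact h.to_subtype
  -- `#X = #ker(cor|_X) · #C`
  have hsplit := natCard_eq_natCard_ker_mul_natCard_map X corSha
  -- `X[2] ↪ ker(cor|_X)`: `res (cor z) = z + τ_* z = 2z = 0` and `cor z ∈ Y ∩ ker res = 0` (case A)
  have hker : Nat.card (AddSubgroup.torsionBy (↥(W.baseChange K).sha) ((2 : ℕ) : ℤ)) ≤ Nat.card (corSha.comp X.subtype).ker := by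
    have hmemX : ∀ z : AddSubgroup.torsionBy (↥(W.baseChange K).sha) ((2 : ℕ) : ℤ), (z : ↥(W.baseChange K).sha) ∈ X := fun z ↦
      (AddCommGroup.mem_primaryComponent).mpr ⟨1, by rw [pow_one]; exact AddSubgroup.torsionBy.nsmul_iff.mp z.2⟩
    have hcor0 : ∀ z : AddSubgroup.torsionBy (↥(W.baseChange K).sha) ((2 : ℕ) : ℤ), corSha (z : ↥(W.baseChange K).sha) = 0 := by
      intro z
      have hz2 : 2 • ((z : ↥(W.baseChange K).sha) : (W.baseChange K).galH1) = 0 := by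
        have h := AddSubgroup.torsionBy.nsmul_iff.mp z.2
        have h' := congrArg (fun u : ↥(W.baseChange K).sha ↦ (u : (W.baseChange K).galH1)) h
        simpa only [AddSubgroupClass.coe_nsmul, ZeroMemClass.coe_zero] using h'
      have hfix := conjH1Points_eq_self_of_shaPrimary W K hIQ hσ1 hT0 hcorT ((z : ↥(W.baseChange K).sha) : (W.baseChange K).galH1)
        (z : ↥(W.baseChange K).sha).2 ⟨1, by rw [pow_one]; exact hz2⟩
      have hres0 : res (cor ((z : ↥(W.baseChange K).sha) : (W.baseChange K).galH1)) = 0 := by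
        rw [hres, hcor, resBaseChange_corBaseChange K W σ h2 hσ1 (isLiftOfAut_liftAut σ), hfix, ← two_nsmul, hz2]
      have hmemYs : cor ((z : ↥(W.baseChange K).sha) : (W.baseChange K).galH1) ∈ Ys :=
        AddSubgroup.mem_map.mpr ⟨corSha (z : ↥(W.baseChange K).sha), hcorY _ (hmemX z), rfl⟩
      exact Subtype.ext (hA _ hmemYs hres0)
    refine Nat.card_le_card_of_injective
      (fun z ↦ (⟨⟨(z : ↥(W.baseChange K).sha), hmemX z⟩, (AddMonoidHom.mem_ker).mpr (hcor0 z)⟩ : (corSha.comp X.subtype).ker)) ?_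
    intro z₁ z₂ h
    exact Subtype.ext (congrArg (fun u : (corSha.comp X.subtype).ker ↦ ((u : X) : ↥(W.baseChange K).sha)) h)
  -- `Y ↪ Hom(C, ℚ/ℤ)` via `y ↦ ⟨y, ·⟩_ℚ|_C`
  obtain ⟨e⟩ := nonempty_addMonoidHom_ratAddCircle_addEquiv C
  haveI : Finite (C →+ AddCircle (1 : ℚ)) := Finite.of_equiv _ e.toEquiv.symm
  have horthY : ∀ y : ↥W.sha, y ∈ Y → (∀ c ∈ C, Bℚ W y c = 0) → y = 0 := by
    intro y hy hyC
    obtain ⟨k, hk⟩ := (AddCommGroup.mem_primaryComponent).mp hy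
    -- `res y` is `2`-primary and orthogonal to `X`
    have hresX : shaRestriction W K y ∈ X :=
      (AddCommGroup.mem_primaryComponent).mpr ⟨k, by rw [← map_nsmul, hk, map_zero]⟩
    have horth : ∀ x ∈ X, BK (W.baseChange K) (shaRestriction W K y) x = 0 := by
      intro x hx
      rw [hadj W y x (hcorE _ x.2)]
      have hc : (⟨cor (x : (W.baseChange K).galH1), hcorE _ x.2⟩ : ↥W.sha) = corSha x := Subtype.ext rfl
      rw [hc]
      exact hyC _ (AddSubgroup.mem_map.mpr ⟨x, hx, rfl⟩)
    have hres0 : shaRestriction W K y = 0 :=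
      eq_zero_of_forall_apply_primaryComponent_eq_zero (W.baseChange K).isTorsion_sha (BK (W.baseChange K))
        (fun x hx ↦ ((hKi (W.baseChange K)).2 x).mp hx) hresX horth
    have hres0' : res (y : W.galH1) = 0 := by
      rw [hres, ← coe_shaRestriction_apply, hres0]; rfl
    exact Subtype.ext (hA (y : W.galH1) (AddSubgroup.mem_map.mpr ⟨y, hy, rfl⟩) hres0')
  have hYC : Nat.card Y ≤ Nat.card C := by
    rw [← Nat.card_congr e.toEquiv]
    refine Nat.card_le_card_of_injective (fun y : Y ↦ ((Bℚ W (y : ↥W.sha)).comp C.subtype : C →+ AddCircle (1 : ℚ))) ?_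
    intro y₁ y₂ h
    have hsub : ∀ c ∈ C, Bℚ W ((y₁ : ↥W.sha) - (y₂ : ↥W.sha)) c = 0 := by
      intro c hc
      have h' := congrArg (fun f : C →+ AddCircle (1 : ℚ) ↦ f ⟨c, hc⟩) h
      simp only [AddMonoidHom.comp_apply, AddSubgroup.coe_subtype] at h'
      rw [map_sub, AddMonoidHom.sub_apply, h', sub_self]
    have h0 := horthY _ (Y.sub_mem y₁.2 y₂.2) hsub
    exact Subtype.ext (sub_eq_zero.mp h0)
  calc Nat.card (AddSubgroup.torsionBy (↥(W.baseChange K).sha) ((2 : ℕ) : ℤ)) * Nat.card Y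
      ≤ Nat.card (corSha.comp X.subtype).ker * Nat.card C := Nat.mul_le_mul hker hYC
    _ = Nat.card X := hsplit.symm

/-! ## §3 The exact law in case A -/

/-- **THE ONE-BIT LAW IS EXACT IN CASE A: `#Ш(E/K)[2^∞] = #Ш(E/K)[2] · #Ш(E/ℚ)[2^∞]`** (modulo `hRC` = Fisher 2.16 and the cor binders):
the prequel's `natCard_shaPrimary_le_torsionBy_mul_natCard` and §2.  On a one-Kolyvagin–McCallum-block cell (`#Ш(E/K)[2] = 4`) this is
`#X = 4·#Y`: X⁼²'s upper half `#X ∣ 4^(M₀)` is EQUIVALENT to `#Ш(E/ℚ)[2^∞] ∣ 4^(M₀−1)`, one bit below Kolyvagin's B₂ over `ℚ`.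
[cite: Fisher2003, Prop. 2.16] [cite: Kramer1981, Thm. 1, Thm. 2] [cite: MilneADT2006, I Thm. 6.13] -/
theorem natCard_shaPrimary_eq_torsionBy_mul_natCard_of_adjoint (hIQ : IsImaginaryQuadratic K) {σ : K ≃ₐ[ℚ] K} (hσ1 : σ ≠ 1)
    (hRC : casselsTate_pairing_resCor K σ hIQ.1 hσ1)
    [Finite (AddCommGroup.primaryComponent (↥W.sha) 2)] [Finite (AddCommGroup.primaryComponent (↥(W.baseChange K).sha) 2)]
    (hT0 : ∀ x ∈ AddCommGroup.primaryComponent (↥(W.quadraticTwist (NumberField.discr K : ℚ)).sha) 2, x = 0)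
    (hcorT : ∀ c : ((W.quadraticTwist (NumberField.discr K : ℚ)).baseChange K).galH1,
        c ∈ ((W.quadraticTwist (NumberField.discr K : ℚ)).baseChange K).sha →
          corBaseChange K (W.quadraticTwist (NumberField.discr K : ℚ)) σ hIQ.1 hσ1 c ∈ (W.quadraticTwist (NumberField.discr K : ℚ)).sha)
    (hcorE : ∀ c : (W.baseChange K).galH1, c ∈ (W.baseChange K).sha → corBaseChange K W σ hIQ.1 hσ1 c ∈ W.sha)
    (hA : ∀ η : W.galH1, η ∈ (AddCommGroup.primaryComponent (↥W.sha) 2).map W.sha.subtype → resBaseChange W K η = 0 → η = 0) :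
    Nat.card (AddCommGroup.primaryComponent (↥(W.baseChange K).sha) 2) =
      Nat.card (AddSubgroup.torsionBy (↥(W.baseChange K).sha) ((2 : ℕ) : ℤ)) * Nat.card (AddCommGroup.primaryComponent (↥W.sha) 2) :=
  le_antisymm (natCard_shaPrimary_le_torsionBy_mul_natCard W K hIQ hσ1 hT0 hcorT hcorE)
    (natCard_torsionBy_mul_natCard_le_natCard_shaPrimary_of_adjoint W K hIQ hσ1 hRC hT0 hcorT hcorE hA)

/-! ## §4 The relaxed index on the frame: `2 · #Ш(E/K)[2] ≤ A`, so `A ≥ 8` on a one-block cell — the budget B⁼²_A is false -/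

/-- **`2 · #Ш(E/K)[2] · #Ш(E/ℚ)[2^∞] ≤ #Ш(E/ℚ)[2^∞] · A`**, `A = [res⁻¹Ш(E_K) : Ш(E/ℚ) ∩ ·]` the relaxed index of the pair sandwich, on its frame
(`K` imaginary quadratic, `σ ≠ 1`, `E(K)[2] = 0`, `rank E(K) ≤ 1`, `y` with `σy + y` torsion and `2^(M+1) ∤ y`), in case A and modulo `hRC`:
`res` maps `res⁻¹X` ONTO `X` (every class of `X` is `τ_*`-fixed by the prequel, and invariant classes are restrictions,
`exists_resBaseChange_eq_of_conjH1Points_eq_of_frame`) with the non-zero Kramer class in its kernel, so `2·#X ≤ #res⁻¹X ≤ #Y · A`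
(`finite_and_natCard_comap_resBaseChange_shaPrimary_le_of_relIndex`), and `#X = #X[2]·#Y` (§3).
[cite: Kramer1981, Thm. 1, §2 Prop. 3, Thm. 2] [cite: GrossLMS1991, §5 (5.1)–(5.3)] [cite: Fisher2003, Prop. 2.16] -/
theorem two_mul_natCard_torsionBy_mul_le_relIndex_mul_of_adjoint_of_frame (hIQ : IsImaginaryQuadratic K) {σ : K ≃ₐ[ℚ] K} (hσ1 : σ ≠ 1)
    (hRC : casselsTate_pairing_resCor K σ hIQ.1 hσ1)
    (h2tors : ∀ P : (W.baseChange K).toAffine.Point, (2 : ℤ) • P = 0 → P = 0)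
    (hrk : (W.baseChange K).mordellWeilRank ≤ 1)
    (y : (W.baseChange K).toAffine.Point) (M : ℕ)
    (hndiv : ∀ Q : (W.baseChange K).toAffine.Point, ((2 ^ (M + 1) : ℕ) : ℤ) • Q ≠ y)
    (hanti : IsOfFinAddOrder (Affine.Point.map (W' := W) (σ : K →ₐ[ℚ] K) y + y))
    [Finite (AddCommGroup.primaryComponent (↥W.sha) 2)] [Finite (AddCommGroup.primaryComponent (↥(W.baseChange K).sha) 2)]
    (hne : (W.sha).relIndex (((W.baseChange K).sha).comap (resBaseChange W K)) ≠ 0)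
    (hT0 : ∀ x ∈ AddCommGroup.primaryComponent (↥(W.quadraticTwist (NumberField.discr K : ℚ)).sha) 2, x = 0)
    (hcorT : ∀ c : ((W.quadraticTwist (NumberField.discr K : ℚ)).baseChange K).galH1,
        c ∈ ((W.quadraticTwist (NumberField.discr K : ℚ)).baseChange K).sha →
          corBaseChange K (W.quadraticTwist (NumberField.discr K : ℚ)) σ hIQ.1 hσ1 c ∈ (W.quadraticTwist (NumberField.discr K : ℚ)).sha)
    (hcorE : ∀ c : (W.baseChange K).galH1, c ∈ (W.baseChange K).sha → corBaseChange K W σ hIQ.1 hσ1 c ∈ W.sha)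
    (hA : ∀ η : W.galH1, η ∈ (AddCommGroup.primaryComponent (↥W.sha) 2).map W.sha.subtype → resBaseChange W K η = 0 → η = 0) :
    2 * Nat.card (AddSubgroup.torsionBy (↥(W.baseChange K).sha) ((2 : ℕ) : ℤ)) * Nat.card (AddCommGroup.primaryComponent (↥W.sha) 2) ≤
      Nat.card (AddCommGroup.primaryComponent (↥W.sha) 2) * (W.sha).relIndex (((W.baseChange K).sha).comap (resBaseChange W K)) := by
  haveI : Fact (Nat.Prime 2) := ⟨Nat.prime_two⟩
  have h2 : Module.finrank ℚ K = 2 := hIQ.1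
  set X : AddSubgroup ↥(W.baseChange K).sha := AddCommGroup.primaryComponent (↥(W.baseChange K).sha) 2 with hX
  set Xs : AddSubgroup (W.baseChange K).galH1 := X.map (W.baseChange K).sha.subtype with hXs
  set res := resBaseChange W K with hres
  set R₂ : AddSubgroup W.galH1 := Xs.comap res with hR₂
  obtain ⟨hR₂fin, hR₂card⟩ := finite_and_natCard_comap_resBaseChange_shaPrimary_le_of_relIndex W K h2 hσ1 hne
  haveI := hR₂fin
  -- `Xs ≤ res(R₂)`: every class of `X` is `τ_*`-fixed, hence a restriction
  have hXsle : Xs ≤ R₂.map res := by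
    intro x hx
    obtain ⟨x', hx', rfl⟩ := AddSubgroup.mem_map.mp hx
    obtain ⟨k, hk⟩ := (AddCommGroup.mem_primaryComponent).mp hx'
    have hk' : 2 ^ k • ((x' : ↥(W.baseChange K).sha) : (W.baseChange K).galH1) = 0 := by
      rw [← AddSubgroupClass.coe_nsmul, hk, ZeroMemClass.coe_zero]
    have hfix := conjH1Points_eq_self_of_shaPrimary W K hIQ hσ1 hT0 hcorT _ x'.2 ⟨k, hk'⟩
    obtain ⟨b, hb⟩ := exists_resBaseChange_eq_of_conjH1Points_eq_of_frame W K h2 hσ1 h2tors hrk y M hndiv hanti hfix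
    refine AddSubgroup.mem_map.mpr ⟨b, ?_, hb⟩
    rw [hR₂, AddSubgroup.mem_comap]
    have hb' : res b = ((x' : ↥(W.baseChange K).sha) : (W.baseChange K).galH1) := hb
    rw [hb']
    exact hx
  haveI hmapfin : Finite (R₂.map res) := by
    have h : ((R₂.map res : AddSubgroup (W.baseChange K).galH1) : Set (W.baseChange K).galH1).Finite := by
      rw [AddSubgroup.coe_map]; exact (Set.toFinite _).image _
    exact h.to_subtype
  have hXcard : Nat.card X ≤ Nat.card (R₂.map res) := by
    rw [Nat.card_congr (X.equivMapOfInjective (W.baseChange K).sha.subtype (W.baseChange K).sha.subtype_injective).toEquiv]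
    exact AddSubgroup.card_le_of_le hXsle
  -- `#R₂ = #ker(res|R₂) · #res(R₂)` with `#ker ≥ 2` (the Kramer class)
  have hsplit := natCard_eq_natCard_ker_mul_natCard_map R₂ res
  obtain ⟨η, hη0, hηres⟩ := exists_ne_zero_resBaseChange_eq_zero_of_frame W K h2 hσ1 h2tors hrk y M hndiv hanti
  have hηR : η ∈ R₂ := by
    rw [hR₂, AddSubgroup.mem_comap]
    have h0 : res η = 0 := hηres
    rw [h0]
    exact Xs.zero_mem
  have hker2 : 2 ≤ Nat.card (res.comp R₂.subtype).ker := by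
    have hnt : Nontrivial (res.comp R₂.subtype).ker := by
      refine ⟨⟨⟨⟨η, hηR⟩, (AddMonoidHom.mem_ker).mpr ?_⟩, 0, fun h ↦ hη0 ?_⟩⟩
      · change res ((⟨η, hηR⟩ : R₂) : W.galH1) = 0
        exact hηres
      · exact congrArg (fun z : (res.comp R₂.subtype).ker ↦ ((z : R₂) : W.galH1)) h
    exact Finite.one_lt_card_iff_nontrivial.mpr hnt
  have heq := natCard_shaPrimary_eq_torsionBy_mul_natCard_of_adjoint W K hIQ hσ1 hRC hT0 hcorT hcorE hA
  calc 2 * Nat.card (AddSubgroup.torsionBy (↥(W.baseChange K).sha) ((2 : ℕ) : ℤ)) * Nat.card (AddCommGroup.primaryComponent (↥W.sha) 2)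
      = 2 * Nat.card X := by rw [mul_assoc, ← heq]
    _ ≤ Nat.card (res.comp R₂.subtype).ker * Nat.card (R₂.map res) := Nat.mul_le_mul hker2 hXcard
    _ = Nat.card R₂ := hsplit.symm
    _ ≤ _ := hR₂card

/-- **`A ≥ 8` on a one-block cell in case A (modulo `hRC`)** — with `#Ш(E/K)[2] = 4` the relaxed index of the pair sandwich is at least `8`
(`2·4·#Y ≤ #Y·A`, `#Y ≥ 1`), so the LINE-24 budget B⁼²_A «`A · A′ ≤ 4`» (card v1.1 §P1, case `ρ_q = 2`) cannot hold on its own frame: the last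
bit of X⁼²'s upper half is not in any budget.  [cite: Kramer1981, Thm. 1, Thm. 2] [cite: Fisher2003, Prop. 2.16] -/
theorem eight_le_relIndex_of_adjoint_of_frame (hIQ : IsImaginaryQuadratic K) {σ : K ≃ₐ[ℚ] K} (hσ1 : σ ≠ 1)
    (hRC : casselsTate_pairing_resCor K σ hIQ.1 hσ1)
    (h2tors : ∀ P : (W.baseChange K).toAffine.Point, (2 : ℤ) • P = 0 → P = 0)
    (hrk : (W.baseChange K).mordellWeilRank ≤ 1)
    (y : (W.baseChange K).toAffine.Point) (M : ℕ)
    (hndiv : ∀ Q : (W.baseChange K).toAffine.Point, ((2 ^ (M + 1) : ℕ) : ℤ) • Q ≠ y)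
    (hanti : IsOfFinAddOrder (Affine.Point.map (W' := W) (σ : K →ₐ[ℚ] K) y + y))
    [Finite (AddCommGroup.primaryComponent (↥W.sha) 2)] [Finite (AddCommGroup.primaryComponent (↥(W.baseChange K).sha) 2)]
    (hne : (W.sha).relIndex (((W.baseChange K).sha).comap (resBaseChange W K)) ≠ 0)
    (hT0 : ∀ x ∈ AddCommGroup.primaryComponent (↥(W.quadraticTwist (NumberField.discr K : ℚ)).sha) 2, x = 0)
    (hcorT : ∀ c : ((W.quadraticTwist (NumberField.discr K : ℚ)).baseChange K).galH1,
        c ∈ ((W.quadraticTwist (NumberField.discr K : ℚ)).baseChange K).sha →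
          corBaseChange K (W.quadraticTwist (NumberField.discr K : ℚ)) σ hIQ.1 hσ1 c ∈ (W.quadraticTwist (NumberField.discr K : ℚ)).sha)
    (hcorE : ∀ c : (W.baseChange K).galH1, c ∈ (W.baseChange K).sha → corBaseChange K W σ hIQ.1 hσ1 c ∈ W.sha)
    (hA : ∀ η : W.galH1, η ∈ (AddCommGroup.primaryComponent (↥W.sha) 2).map W.sha.subtype → resBaseChange W K η = 0 → η = 0)
    (hX4 : Nat.card (AddSubgroup.torsionBy (↥(W.baseChange K).sha) ((2 : ℕ) : ℤ)) = 4) :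
    8 ≤ (W.sha).relIndex (((W.baseChange K).sha).comap (resBaseChange W K)) := by
  have h := two_mul_natCard_torsionBy_mul_le_relIndex_mul_of_adjoint_of_frame W K hIQ hσ1 hRC h2tors hrk y M hndiv hanti hne hT0 hcorT
    hcorE hA
  rw [hX4] at h
  have hYpos : 0 < Nat.card (AddCommGroup.primaryComponent (↥W.sha) 2) := Nat.card_pos
  have h' : 8 * Nat.card (AddCommGroup.primaryComponent (↥W.sha) 2) ≤
      (W.sha).relIndex (((W.baseChange K).sha).comap (resBaseChange W K)) * Nat.card (AddCommGroup.primaryComponent (↥W.sha) 2) := by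
    calc 8 * Nat.card (AddCommGroup.primaryComponent (↥W.sha) 2)
        = 2 * 4 * Nat.card (AddCommGroup.primaryComponent (↥W.sha) 2) := by norm_num
      _ ≤ _ := h
      _ = _ := mul_comm _ _
  exact Nat.le_of_mul_le_mul_right h' hYpos

end LowerBound

end Summit.BirchSwinnertonDyer.BirchSwinnertonDyer.Theorems.GenusExact.PlusDescent.OneBit

end
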